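import Summits.AtomisticToContinuum.BoseEinsteinCondensation.Theorems.ScaleConvexityDyadicNesting

/-!
# Route ScaleConvexity — `stub_fracMono`: the dyadic coherent-fraction profile is non-decreasing in the level

Registered stub `stub_fracMono` of the birth skeleton of crux `NonSteepeningFromUniform`
(item stmt-AtomisticToContinuum-30006, decomp-a2c lens-6 g7): for every trial state `Ψ` in the box of side
`L = L_N(ρ) > 0` and every dyadic level `j`,
`Φ_j(Ψ) ≤ Φ_(j+1)(Ψ)`, where `Φ_j = max_q modeOcc(Q_q)/mass(Q_q)` over the `8^j` grid cubes `Q_q` of side `L/2^j`.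

Proof (the MEDIANT argument on the LOCALISED weighted tiling): a level-`j` cube `P` is the disjoint union of its
`8` children `Q_q` (half-open dyadic cells nest); for a normalised mode `φ` on `P`, slice-by-slice Cauchy–Schwarz
over the children gives `⟨φ, γ_Ψ φ⟩ ≤ Σ_(q child) modeOcc(Q_q)` (tiles outside `P` carry no weight), and
`modeOcc(Q_q) ≤ Φ_(j+1) · mass(Q_q)` with `Σ_(q child) mass(Q_q) = mass(P)`; hence
`modeOcc(P) ≤ Φ_(j+1) · mass(P)`.  (`N = 0`: all occupations vanish.)  [folklore bookkeeping; objects LSSY2005 §1.2]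
-/

noncomputable section

noncomputable section

namespace Summit.AtomisticToContinuum.BoseEinsteinCondensation.Theorems.ScaleConvexityFracMono

open Summit.AtomisticToContinuum.BoseEinsteinCondensation.Theorems.ScaleConvexityFractionCalculus
open Summit.AtomisticToContinuum.BoseEinsteinCondensation.Theorems.ScaleConvexityDyadicNesting
open scoped BigOperators Topology Classical MeasureTheory ComplexConjugate ENNReal NNReal
open Filter Set Function MeasureTheory
open Literature.MathematicalPhysics.QuantumManyBody.BoseGas

section Tiling

variable {n : ℕ} {L ℓ : ℝ} {j : ℕ}

/-- **LOCALISED WEIGHTED TILING**: for a normalised mode `φ` on a level-`j` cell `P`,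
`⟨φ, γ_Ψ φ⟩ ≤ Σ_(q child of P) modeOcc(Q_q)`. -/
theorem occupation_le_sum_children (hℓ : 0 < ℓ) (hL : L ≤ ((2 ^ (j + 1) : ℕ) : ℝ) * ℓ)
    (Ψ : TrialState (n + 1) L) (p : SubIdx (2 ^ j)) {φ : EuclideanSpace ℝ (Fin 3) → ℂ}
    (hφ : IsModeOn (subCell (2 * ℓ) p) φ) :
    occupation (n + 1) φ Ψ.ψ ≤ ∑ q ∈ children p, modeOcc (n + 1) (subCell ℓ q) Ψ.ψ := by
  obtain ⟨hφae, hφ1, hφ0⟩ := hφ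
  -- WLOG `φ` is measurable
  set φm : EuclideanSpace ℝ (Fin 3) → ℂ := hφae.mk φ with hφm
  have hφmm : Measurable φm := hφae.stronglyMeasurable_mk.measurable
  have hae : φ =ᵐ[volume] φm := hφae.ae_eq_mk
  have hφm1 : (∫⁻ x, (‖φm x‖₊ : ℝ≥0∞) ^ 2) = 1 := by
    rw [← hφ1]
    exact lintegral_congr_ae (hae.mono fun x hx => by simp [hx])
  rw [occupation_congr_ae hae]
  -- tile masses
  have htile : ∀ q : SubIdx (2 ^ (j + 1)),
      (∫⁻ x, (‖(subCell ℓ q).indicator φm x‖₊ : ℝ≥0∞) ^ 2) =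
        ∫⁻ x in subCell ℓ q, (‖φm x‖₊ : ℝ≥0∞) ^ 2 :=
    fun q => lintegral_indicator_sq (measurableSet_subCell ℓ q) φm
  have hsum : ∑ q : SubIdx (2 ^ (j + 1)), ∫⁻ x in subCell ℓ q, (‖φm x‖₊ : ℝ≥0∞) ^ 2 ≤ 1 := by
    rw [← hφm1]
    exact sum_setLIntegral_subCell_le hℓ (hφmm.nnnorm.coe_nnreal_ennreal.pow_const 2).aemeasurable
  have hfin : ∀ q : SubIdx (2 ^ (j + 1)),
      (∫⁻ x, (‖(subCell ℓ q).indicator φm x‖₊ : ℝ≥0∞) ^ 2) ≠ ∞ := by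
    intro q
    rw [htile q]
    refine ne_top_of_le_ne_top ENNReal.one_ne_top (le_trans ?_ hsum)
    exact Finset.single_le_sum (f := fun q => ∫⁻ x in subCell ℓ q, (‖φm x‖₊ : ℝ≥0∞) ^ 2)
      (fun _ _ => bot_le) (Finset.mem_univ q)
  choose r ψ hψm hr hslice hocc using
    fun q : SubIdx (2 ^ (j + 1)) => tile_mode (measurableSet_subCell ℓ q) Ψ hφmm (hfin q)
  -- tiles off the children carry no weight
  have hr0 : ∀ q : SubIdx (2 ^ (j + 1)), q ∉ children p → r q = 0 := by
    intro q hq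
    have hzero : ∫⁻ x in subCell ℓ q, (‖φm x‖₊ : ℝ≥0∞) ^ 2 = 0 := by
      have hcongr : ∫⁻ x in subCell ℓ q, (‖φm x‖₊ : ℝ≥0∞) ^ 2 = ∫⁻ x in subCell ℓ q, (‖φ x‖₊ : ℝ≥0∞) ^ 2 :=
        lintegral_congr_ae ((ae_restrict_of_ae hae).mono fun x hx => by simp [hx])
      rw [hcongr]
      refine (setLIntegral_congr_fun (measurableSet_subCell ℓ q) (fun x hx => ?_)).trans lintegral_zero
      have hxP : x ∉ subCell (2 * ℓ) p := fun hxP => hq (mem_children.2 (parentIdx_eq_of_mem hℓ hx hxP))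
      simp [hφ0 x hxP]
    have h := hr q
    rw [htile q, hzero] at h
    have h' : (r q : ℝ≥0∞) = 0 := by simpa using h
    exact_mod_cast h'
  -- `Σ_children r_q² ≤ 1`
  have hr1 : ∑ q ∈ children p, r q ^ 2 ≤ 1 := by
    have h : ((∑ q ∈ children p, r q ^ 2 : ℝ≥0) : ℝ≥0∞) ≤ 1 := by
      push_cast
      calc ∑ q ∈ children p, (r q : ℝ≥0∞) ^ 2
          ≤ ∑ q : SubIdx (2 ^ (j + 1)), (r q : ℝ≥0∞) ^ 2 :=
            Finset.sum_le_sum_of_subset_of_nonneg (Finset.subset_univ _) fun _ _ _ => bot_le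
        _ = ∑ q : SubIdx (2 ^ (j + 1)), ∫⁻ x in subCell ℓ q, (‖φm x‖₊ : ℝ≥0∞) ^ 2 :=
            Finset.sum_congr rfl fun q _ => by rw [hr q, htile q]
        _ ≤ 1 := hsum
    exact_mod_cast h
  -- slice bound
  set B : SubIdx (2 ^ (j + 1)) → Config n → ℂ :=
    fun q Y => ∫ x, conj (ψ q x) * Ψ.ψ (Matrix.vecCons x Y) with hB
  have hsl : ∀ Y : Config n,
      (‖∫ x, conj (φm x) * Ψ.ψ (Matrix.vecCons x Y)‖₊ : ℝ≥0∞) ^ 2 ≤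
        ∑ q ∈ children p, (‖B q Y‖₊ : ℝ≥0∞) ^ 2 := by
    intro Y
    set f : EuclideanSpace ℝ (Fin 3) → ℂ := fun x => conj (φm x) * Ψ.ψ (Matrix.vecCons x Y) with hfdef
    have hf0 : ∀ x, x ∉ cell (((2 ^ (j + 1) : ℕ) : ℝ) * ℓ) → f x = 0 := fun x hx => by
      simp only [hfdef, slice_eq_zero' Ψ (fun h => hx (box_subset_cell hL h)) Y, mul_zero]
    have hpiece : ∀ q : SubIdx (2 ^ (j + 1)),
        (subCell ℓ q).indicator f =
          fun x => conj ((subCell ℓ q).indicator φm x) * Ψ.ψ (Matrix.vecCons x Y) := by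
      intro q; funext x
      by_cases hx : x ∈ subCell ℓ q
      · simp only [hfdef, Set.indicator_of_mem hx]
      · simp only [hfdef, Set.indicator_of_notMem hx, map_zero, zero_mul]
    by_cases hint : Integrable f volume
    · have hsplit : ∫ x, f x = ∑ q : SubIdx (2 ^ (j + 1)), ∫ x, (subCell ℓ q).indicator f x := by
        rw [← integral_finsetSum Finset.univ fun q _ => hint.indicator (measurableSet_subCell ℓ q)]
        exact integral_congr_ae (Eventually.of_forall fun x => (sum_indicator_subCell' hℓ f hf0 x).symm)
      have hAq : ∀ q : SubIdx (2 ^ (j + 1)),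
          ∫ x, (subCell ℓ q).indicator f x = ((r q : ℝ) : ℂ) * B q Y := by
        intro q; rw [hpiece q]; exact hslice q Y
      have hnn : ‖∫ x, f x‖₊ ≤ ∑ q ∈ children p, r q * ‖B q Y‖₊ := by
        rw [hsplit]
        refine (nnnorm_sum_le _ _).trans (le_of_eq ?_)
        have hall : ∑ q : SubIdx (2 ^ (j + 1)), ‖∫ x, (subCell ℓ q).indicator f x‖₊ =
            ∑ q : SubIdx (2 ^ (j + 1)), r q * ‖B q Y‖₊ :=
          Finset.sum_congr rfl fun q _ => by rw [hAq q, nnnorm_mul]; simp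
        rw [hall]
        exact (Finset.sum_subset (Finset.subset_univ _)
          fun q _ hq => by rw [hr0 q hq, zero_mul]).symm
      have hcs : (∑ q ∈ children p, r q * ‖B q Y‖₊) ^ 2 ≤
          (∑ q ∈ children p, r q ^ 2) * ∑ q ∈ children p, ‖B q Y‖₊ ^ 2 :=
        Finset.sum_mul_sq_le_sq_mul_sq (children p) r fun q => ‖B q Y‖₊
      have hkey : ‖∫ x, f x‖₊ ^ 2 ≤ ∑ q ∈ children p, ‖B q Y‖₊ ^ 2 :=
        calc ‖∫ x, f x‖₊ ^ 2 ≤ (∑ q ∈ children p, r q * ‖B q Y‖₊) ^ 2 := pow_le_pow_left₀ bot_le hnn 2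
          _ ≤ (∑ q ∈ children p, r q ^ 2) * ∑ q ∈ children p, ‖B q Y‖₊ ^ 2 := hcs
          _ ≤ 1 * ∑ q ∈ children p, ‖B q Y‖₊ ^ 2 := by gcongr
          _ = _ := one_mul _
      have := ENNReal.coe_le_coe.2 hkey
      push_cast at this
      exact this
    · rw [integral_undef hint]
      simp
  -- integrate over the slices
  have hmeas : ∀ q : SubIdx (2 ^ (j + 1)), Measurable fun Y : Config n => (‖B q Y‖₊ : ℝ≥0∞) ^ 2 :=
    fun q => measurable_slicePairing_sq Ψ (hψm q)
  calc occupation (n + 1) φm Ψ.ψ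
      = (n + 1 : ℝ≥0∞) * ∫⁻ Y : Config n,
          (‖∫ x, conj (φm x) * Ψ.ψ (Matrix.vecCons x Y)‖₊ : ℝ≥0∞) ^ 2 := by
        simp only [occupation]
    _ ≤ (n + 1 : ℝ≥0∞) * ∫⁻ Y : Config n, ∑ q ∈ children p, (‖B q Y‖₊ : ℝ≥0∞) ^ 2 := by
        gcongr with Y; exact hsl Y
    _ = ∑ q ∈ children p, (n + 1 : ℝ≥0∞) * ∫⁻ Y : Config n, (‖B q Y‖₊ : ℝ≥0∞) ^ 2 := by
        rw [lintegral_finsetSum' _ fun q _ => (hmeas q).aemeasurable, Finset.mul_sum]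
    _ = ∑ q ∈ children p, occupation (n + 1) (ψ q) Ψ.ψ := by simp only [occupation, hB]
    _ ≤ ∑ q ∈ children p, modeOcc (n + 1) (subCell ℓ q) Ψ.ψ :=
        Finset.sum_le_sum fun q _ => hocc q

/-- Hence `modeOcc(P) ≤ Σ_(children) modeOcc(Q_q)`. -/
theorem modeOcc_parent_le (hℓ : 0 < ℓ) (hL : L ≤ ((2 ^ (j + 1) : ℕ) : ℝ) * ℓ)
    (Ψ : TrialState (n + 1) L) (p : SubIdx (2 ^ j)) :
    modeOcc (n + 1) (subCell (2 * ℓ) p) Ψ.ψ ≤ ∑ q ∈ children p, modeOcc (n + 1) (subCell ℓ q) Ψ.ψ :=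
  iSup₂_le fun _ hφ => occupation_le_sum_children hℓ hL Ψ p hφ

/-- Masses are finite: `mass(Q) ≤ N`. -/
theorem mass_le (Q : Set (EuclideanSpace ℝ (Fin 3))) (Ψ : TrialState (n + 1) L) :
    mass (n + 1) Q Ψ.ψ ≤ (n + 1 : ℝ≥0∞) := by
  have hΨ : Measurable Ψ.ψ := Ψ.contDiff.continuous.measurable
  calc mass (n + 1) Q Ψ.ψ ≤ ∫⁻ x, oneParticleDensity (n + 1) Ψ.ψ x := setLIntegral_le_lintegral _ _
    _ = (n + 1 : ℝ≥0∞) := by rw [lintegral_oneParticleDensity hΨ, Ψ.norm_eq, mul_one]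

/-- The one-particle density of a trial state is measurable. -/
theorem measurable_oneParticleDensity (Ψ : TrialState (n + 1) L) :
    Measurable (oneParticleDensity (n + 1) Ψ.ψ) := by
  have hΨ : Measurable Ψ.ψ := Ψ.contDiff.continuous.measurable
  have : oneParticleDensity (n + 1) Ψ.ψ = fun x => (n + 1 : ℝ≥0∞) * sliceMass Ψ.ψ x := by
    funext x; simp [oneParticleDensity]
  rw [this]
  exact measurable_const.mul (measurable_sliceMass hΨ)

/-- **FRACTION MONOTONICITY** (the mediant step): `Φ_j ≤ Φ_(j+1)` for `N ≥ 1`, `L > 0`. -/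
theorem frac_mono_succ (hLpos : 0 < L) (Ψ : TrialState (n + 1) L) (j : ℕ) :
    (⨆ p : SubIdx (2 ^ j), modeOcc (n + 1) (subCell (L / 2 ^ j) p) Ψ.ψ /
        mass (n + 1) (subCell (L / 2 ^ j) p) Ψ.ψ) ≤
      ⨆ q : SubIdx (2 ^ (j + 1)), modeOcc (n + 1) (subCell (L / 2 ^ (j + 1)) q) Ψ.ψ /
        mass (n + 1) (subCell (L / 2 ^ (j + 1)) q) Ψ.ψ := by
  set ℓ : ℝ := L / 2 ^ (j + 1) with hℓdef
  have hℓ : 0 < ℓ := by positivity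
  have h2ℓ : L / 2 ^ j = 2 * ℓ := by
    rw [hℓdef, pow_succ]; field_simp
  have hLk : L ≤ ((2 ^ (j + 1) : ℕ) : ℝ) * ℓ := by
    rw [hℓdef]; push_cast; rw [mul_div_cancel₀ _ (by positivity)]
  rw [h2ℓ]
  set M : ℝ≥0∞ := ⨆ q : SubIdx (2 ^ (j + 1)), modeOcc (n + 1) (subCell ℓ q) Ψ.ψ /
      mass (n + 1) (subCell ℓ q) Ψ.ψ with hM
  by_cases hMtop : M = ⊤
  · rw [hMtop]; exact le_top
  refine iSup_le fun p => ?_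
  -- each child: `modeOcc ≤ M · mass`
  have hchild : ∀ q : SubIdx (2 ^ (j + 1)),
      modeOcc (n + 1) (subCell ℓ q) Ψ.ψ ≤ M * mass (n + 1) (subCell ℓ q) Ψ.ψ := by
    intro q
    have hq : modeOcc (n + 1) (subCell ℓ q) Ψ.ψ / mass (n + 1) (subCell ℓ q) Ψ.ψ ≤ M :=
      le_iSup (fun q : SubIdx (2 ^ (j + 1)) =>
        modeOcc (n + 1) (subCell ℓ q) Ψ.ψ / mass (n + 1) (subCell ℓ q) Ψ.ψ) q
    have hmt : mass (n + 1) (subCell ℓ q) Ψ.ψ ≠ ⊤ :=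
      ne_top_of_le_ne_top (by simp) (mass_le _ Ψ)
    exact (ENNReal.div_le_iff_le_mul (Or.inr hMtop) (Or.inl hmt)).1 hq
  refine ENNReal.div_le_of_le_mul ?_
  calc modeOcc (n + 1) (subCell (2 * ℓ) p) Ψ.ψ
      ≤ ∑ q ∈ children p, modeOcc (n + 1) (subCell ℓ q) Ψ.ψ := modeOcc_parent_le hℓ hLk Ψ p
    _ ≤ ∑ q ∈ children p, M * mass (n + 1) (subCell ℓ q) Ψ.ψ := Finset.sum_le_sum fun q _ => hchild q
    _ = M * mass (n + 1) (subCell (2 * ℓ) p) Ψ.ψ := by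
        rw [← Finset.mul_sum, mass_parent_eq_sum hℓ p Ψ.ψ (measurable_oneParticleDensity Ψ)]

end Tiling

/-! ### The registered stub, BY NAME and verbatim signature -/

/-- **`stub_fracMono`** (registered stub of the birth skeleton of `ScaleConvexity.NonSteepeningFromUniform`,
item stmt-AtomisticToContinuum-30006): the dyadic coherent-fraction profile is non-decreasing in the level.
[folklore bookkeeping; LSSY2005 §1.2 for the objects] -/
theorem stub_fracMono : ∀ (ρ : ℝ) (N : ℕ), 0 < Literature.MathematicalPhysics.QuantumManyBody.BoseGas.sideLength ρ N → ∀ Ψ : Literature.MathematicalPhysics.QuantumManyBody.BoseGas.TrialState N (Literature.MathematicalPhysics.QuantumManyBody.BoseGas.sideLength ρ N), ∀ Φ : ℕ → ENNReal, (∀ j : ℕ, Φ j = ⨆ q : Literature.MathematicalPhysics.QuantumManyBody.BoseGas.SubIdx (2 ^ j), (⨆ (φ : EuclideanSpace ℝ (Fin 3) → ℂ) (_ : MeasureTheory.AEStronglyMeasurable φ MeasureTheory.volume ∧ (∫⁻ x, (‖φ x‖₊ : ENNReal) ^ 2) = 1 ∧ ∀ x : EuclideanSpace ℝ (Fin 3),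 x ∉ Literature.MathematicalPhysics.QuantumManyBody.BoseGas.subCell (Literature.MathematicalPhysics.QuantumManyBody.BoseGas.sideLength ρ N / 2 ^ j) q → φ x = 0), Literature.MathematicalPhysics.QuantumManyBody.BoseGas.occupation N φ Ψ.ψ) / (∫⁻ x in Literature.MathematicalPhysics.QuantumManyBody.BoseGas.subCell (Literature.MathematicalPhysics.QuantumManyBody.BoseGas.sideLength ρ N / 2 ^ j) q, Literature.MathematicalPhysics.QuantumManyBody.BoseGas.oneParticleDensity N Ψ.ψ x)) → ∀ j : ℕ, Φ j ≤ Φ (j + 1) := by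
  intro ρ N hL Ψ Φ hΦ j
  rw [hΦ j, hΦ (j + 1)]
  cases N with
  | zero => simp [occupation]
  | succ n => exact frac_mono_succ hL Ψ j

end Summit.AtomisticToContinuum.BoseEinsteinCondensation.Theorems.ScaleConvexityFracMono
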